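import Summits.CriticalPhenomena.PercolationContinuityZ3.Theorems.PercNearOneGluingNoHeavyLowerTailAntitheticDomTopBoxes
import HarnessLib

/-!
# `NoHeavyLowerTail` (stmt-CriticalPhenomena-4575) — antithetic cluster pairs: **THE TOP EVENT AT A VERTEX DOMINATING THE SOURCE —
# THEOREM TXG** (prim-hp-2 gen 73, HOME/THEOREM-TW.md §3bis)

Support file (`--supports stmt-CriticalPhenomena-4575`, hull-port prover `prim-hp-2`, gen 73).  No definitions, no named facts, no sorries;
standard axioms.  Notation of …AntitheticDomTopBoxes: `P` dominates the source `s` (`s ≠ P`, `sP ∉ E`, `N(s) ⊆ N(P)`, `hdom`).  The top event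
splits into the red–red part, the cross part (both nonnegative, …AntitheticDomTopBoxes) and the REST: no neighbour of `s` red–red and no `E`-pair
between the blue-`s` neighbours `J` and the red-`s` neighbours `K`.
* `Antithetic.Dom.nested_of_rest` — on the rest the tops are NESTED (`Y T ⊆ X T`) provided (`hcut`) for every cut `(S, N(s) ∖ S)` of `N(s)`
  with both sides nonempty and no crossing `E`-pair, every non-isolated vertex outside `N(s) ∪ N(P) ∪ {s, P}` has a neighbour in `N(s) ∖ S`
  (vertices adjacent to `P` need nothing: a blue pair `Pw` would put `P` into `Y`; `J = ∅` gives `Y T = {s}`).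
* `Antithetic.Dom.top_sum_nonneg_of_cut`, `Antithetic.Dom.vertex_sum_nonneg_of_cut` — **THEOREM TXG**: under `hdom` + `hcut`, TOP(E; P) ≥ 0 in
  `K`-form and the |R| = 1 VERTEX ANTITHETIC INEQUALITY holds at `P` (contains the twin theorems TA / TC / TX).
* `Antithetic.Dom.vertex_sum_nonneg_of_connected` — **COROLLARY: for EVERY finite graph, every source `s` whose neighbourhood induces a
  CONNECTED subgraph, and every vertex `P ≁ s` adjacent to all neighbours of `s`, VERTEX({P}) holds** — e.g. `s` on a triangle `s a b` and `P`
  any common neighbour of `a, b`, whatever else `P` and the graph contain.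
[cite: VandenbergHaggstromKahn2005, §1 p. 6 ("Harris' inequality"), §1 p. 3 (open cluster `C_s`)]
-/

noncomputable section

namespace Summit.CriticalPhenomena.PercolationContinuityZ3.Theorems

open Literature.Probability.Percolation
open scoped Classical

namespace Antithetic

namespace Dom

variable {V : Type*}

/-- **Nested tops on the rest, dominating case.**  `hcut`: for every cut of `N(s)` with both sides nonempty and no crossing `E`-pair,
every non-isolated vertex outside `N(s) ∪ N(P) ∪ {s, P}` has a neighbour on the red-`s` side. [this work] -/
theorem nested_of_rest {E : Set (Sym2 V)} {s P : V} (hsP : s ≠ P) (hsPE : s(s, P) ∉ E)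
    (hdom : ∀ v, v ≠ s → v ≠ P → s(s, v) ∈ E → s(P, v) ∈ E)
    (hcut : ∀ S : Set V, (∃ j ∈ S, j ≠ s ∧ j ≠ P ∧ s(s, j) ∈ E) → (∃ k ∉ S, k ≠ s ∧ k ≠ P ∧ s(s, k) ∈ E) →
      (∀ j k, j ∈ S → k ∉ S → j ≠ s → j ≠ P → s(s, j) ∈ E → k ≠ s → k ≠ P → s(s, k) ∈ E → s(j, k) ∉ E) →
      ∀ w u, w ≠ s → w ≠ P → s(s, w) ∉ E → s(P, w) ∉ E → u ≠ w → s(u, w) ∈ E →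
        ∃ k ∉ S, k ≠ s ∧ k ≠ P ∧ s(s, k) ∈ E ∧ s(w, k) ∈ E)
    {T : Set (Sym2 V)} (hPX : P ∈ openCluster (T ∩ E) s) (hPY : P ∉ openCluster (Tᶜ ∩ E) s)
    (hnoRR : ∀ v, v ≠ s → v ≠ P → s(s, v) ∈ E → ¬ (s(s, v) ∈ T ∧ s(P, v) ∈ T))
    (hnoX : ∀ j k, j ≠ s → j ≠ P → s(s, j) ∈ E → k ≠ s → k ≠ P → s(s, k) ∈ E → s(s, j) ∉ T → s(s, k) ∈ T →
      s(j, k) ∈ E → s(j, k) ∉ T) :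
    openCluster (Tᶜ ∩ E) s ⊆ openCluster (T ∩ E) s := by
  let S : Set V := {v | s(s, v) ∉ T}
  by_cases hJ : ∃ j ∈ S, j ≠ s ∧ j ≠ P ∧ s(s, j) ∈ E
  swap
  · -- every pair at `s` is red: the blue cluster is `{s}`
    have hYs : openCluster (Tᶜ ∩ E) s ⊆ {s} := by
      refine TwoStage.Fan.cluster_subset_of_closed (Set.mem_singleton s) fun u w hu huw => ?_
      obtain ⟨⟨hTb, hE'⟩, hne⟩ := (openGraph_adj _ u w).1 huw
      rw [Set.mem_singleton_iff] at hu
      subst hu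
      exfalso
      by_cases hwP : w = P
      · exact hsPE (hwP ▸ hE')
      · exact hJ ⟨w, hTb, Ne.symm hne, hwP, hE'⟩
    intro u hu
    rw [Set.mem_singleton_iff.1 (hYs hu)]
    exact mem_openCluster_self _ s
  have hK : ∃ k ∉ S, k ≠ s ∧ k ≠ P ∧ s(s, k) ∈ E := by
    by_contra hK
    have hXs : openCluster (T ∩ E) s ⊆ {s} := by
      refine TwoStage.Fan.cluster_subset_of_closed (Set.mem_singleton s) fun u w hu huw => ?_
      obtain ⟨⟨hTr, hE'⟩, hne⟩ := (openGraph_adj _ u w).1 huw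
      rw [Set.mem_singleton_iff] at hu
      subst hu
      exfalso
      by_cases hwP : w = P
      · exact hsPE (hwP ▸ hE')
      · exact hK ⟨w, fun h => h hTr, Ne.symm hne, hwP, hE'⟩
    exact hsP (Set.mem_singleton_iff.1 (hXs hPX)).symm
  have hnocross : ∀ j k, j ∈ S → k ∉ S → j ≠ s → j ≠ P → s(s, j) ∈ E → k ≠ s → k ≠ P → s(s, k) ∈ E → s(j, k) ∉ E := by
    intro j k hj hk hjs hjP hjE hks hkP hkE hjkE
    have hsj : s(s, j) ∉ T := hj
    have hsk : s(s, k) ∈ T := by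
      by_contra h
      exact hk h
    have hPk : s(P, k) ∉ T := fun h => hnoRR k hks hkP hkE ⟨hsk, h⟩
    have hjk : j ≠ k := fun h => hsj (h ▸ hsk)
    exact hnoX j k hjs hjP hjE hks hkP hkE hsj hsk hjkE (cross_red_of_top hdom hPY hjs hks hkP hjE hkE hsj hPk hjkE hjk)
  have hcut' := hcut S hJ hK hnocross
  suffices h : openCluster (Tᶜ ∩ E) s ⊆ openCluster (T ∩ E) s ∩ openCluster (Tᶜ ∩ E) s from fun u hu => (h hu).1
  refine TwoStage.Fan.cluster_subset_of_closed ⟨mem_openCluster_self _ s, mem_openCluster_self _ s⟩ fun u w hu huw => ?_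
  obtain ⟨⟨hTb, hE⟩, hne⟩ := (openGraph_adj _ u w).1 huw
  have hwY : w ∈ openCluster (Tᶜ ∩ E) s := Twin.mem_blue_of_pair hu.2 hTb hE hne
  refine ⟨?_, hwY⟩
  by_cases hws : w = s
  · rw [hws]; exact mem_openCluster_self _ s
  have hwP : w ≠ P := fun h => hPY (h ▸ hwY)
  by_cases hwN : s(s, w) ∈ E
  · exact nbr_mem_red_of_top hdom hPX hPY hws hwP hwN
  by_cases hwNP : s(P, w) ∈ E
  · -- a private neighbour of `P`: its pair to `P` is red (else `P ∈ Y`)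
    by_cases hPw : s(P, w) ∈ T
    · exact Twin.mem_red_of_pair hPX hPw hwNP (Ne.symm hwP)
    · exact absurd (Twin.mem_blue_of_pair hwY (by rw [Sym2.eq_swap]; exact hPw) (by rw [Sym2.eq_swap]; exact hwNP) hwP) hPY
  · -- a far vertex: it has a neighbour `k` on the red-`s` side
    obtain ⟨k, hkS, hks, hkP, hkE, hwk⟩ := hcut' w u hws hwP hwN hwNP hne hE
    have hsk : s(s, k) ∈ T := by
      by_contra h
      exact hkS h
    have hkw : k ≠ w := fun h => hwN (h ▸ hkE)
    by_cases hred : s(w, k) ∈ T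
    · have hkX : k ∈ openCluster (T ∩ E) s := Twin.mem_red_of_pair (mem_openCluster_self _ s) hsk hkE hks.symm
      exact Twin.mem_red_of_pair hkX (by rw [Sym2.eq_swap]; exact hred) (by rw [Sym2.eq_swap]; exact hwk) hkw
    · exfalso
      have hkY : k ∈ openCluster (Tᶜ ∩ E) s := Twin.mem_blue_of_pair hwY hred hwk (Ne.symm hkw)
      have hPk : s(P, k) ∉ T := fun h => hnoRR k hks hkP hkE ⟨hsk, h⟩
      exact hPY (Twin.mem_blue_of_pair hkY (by rw [Sym2.eq_swap]; exact hPk) (by rw [Sym2.eq_swap]; exact hdom k hks hkP hkE) hkP)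

variable [Fintype V]

/-- **THEOREM TXG (top form, `K`-form).**  `P` dominates the source (`s ≠ P`, `sP ∉ E`, `N(s) ⊆ N(P)`) and the cut hypothesis `hcut` holds
(vacuous when `G[N(s)]` is connected).  Then `0 ≤ Σ_{T : P ∈ X T, P ∉ Y T} K₁(X T, Y T)·K₂(X T, Y T)`. [this work] -/
theorem top_sum_nonneg_of_cut (E : Set (Sym2 V)) (s P : V) (hsP : s ≠ P) (hsPE : s(s, P) ∉ E)
    (hdom : ∀ v, v ≠ s → v ≠ P → s(s, v) ∈ E → s(P, v) ∈ E)
    (hcut : ∀ S : Set V, (∃ j ∈ S, j ≠ s ∧ j ≠ P ∧ s(s, j) ∈ E) → (∃ k ∉ S, k ≠ s ∧ k ≠ P ∧ s(s, k) ∈ E) →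
      (∀ j k, j ∈ S → k ∉ S → j ≠ s → j ≠ P → s(s, j) ∈ E → k ≠ s → k ≠ P → s(s, k) ∈ E → s(j, k) ∉ E) →
      ∀ w u, w ≠ s → w ≠ P → s(s, w) ∉ E → s(P, w) ∉ E → u ≠ w → s(u, w) ∈ E →
        ∃ k ∉ S, k ≠ s ∧ k ≠ P ∧ s(s, k) ∈ E ∧ s(w, k) ∈ E)
    {K₁ K₂ : Set V → Set V → ℝ}
    (hK₁ : ∀ ⦃A A' B B' : Set V⦄, A ⊆ A' → B' ⊆ B → K₁ A B ≤ K₁ A' B') (hso₁ : ∀ A B, 0 ≤ K₁ A B + K₁ B A)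
    (hK₂ : ∀ ⦃A A' B B' : Set V⦄, A ⊆ A' → B' ⊆ B → K₂ A B ≤ K₂ A' B') (hso₂ : ∀ A B, 0 ≤ K₂ A B + K₂ B A) :
    0 ≤ ∑ T ∈ Finset.univ.filter (fun T : Set (Sym2 V) => P ∈ openCluster (T ∩ E) s ∧ P ∉ openCluster (Tᶜ ∩ E) s),
      K₁ (openCluster (T ∩ E) s) (openCluster (Tᶜ ∩ E) s) * K₂ (openCluster (T ∩ E) s) (openCluster (Tᶜ ∩ E) s) := by
  have hrr := top_rr_sum_nonneg E s P hdom hK₁ hso₁ hK₂ hso₂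
  have hcr := top_cross_sum_nonneg E s P hdom hK₁ hso₁ hK₂ hso₂
  have hdisj : Disjoint
      (Finset.univ.filter (fun T : Set (Sym2 V) => P ∈ openCluster (T ∩ E) s ∧ P ∉ openCluster (Tᶜ ∩ E) s ∧
        ∃ v, v ≠ s ∧ v ≠ P ∧ s(s, v) ∈ E ∧ s(s, v) ∈ T ∧ s(P, v) ∈ T))
      (Finset.univ.filter (fun T : Set (Sym2 V) => P ∈ openCluster (T ∩ E) s ∧ P ∉ openCluster (Tᶜ ∩ E) s ∧
        (∀ v, v ≠ s → v ≠ P → s(s, v) ∈ E → ¬ (s(s, v) ∈ T ∧ s(P, v) ∈ T)) ∧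
        ∃ j k, j ≠ s ∧ j ≠ P ∧ s(s, j) ∈ E ∧ k ≠ s ∧ k ≠ P ∧ s(s, k) ∈ E ∧ s(s, j) ∉ T ∧ s(s, k) ∈ T ∧
          s(j, k) ∈ E ∧ s(j, k) ∈ T)) := by
    rw [Finset.disjoint_filter]
    rintro T - ⟨-, -, v, hvs, hvP, hvE, h1, h2⟩ ⟨-, -, hno, -⟩
    exact hno v hvs hvP hvE ⟨h1, h2⟩
  have hsum := add_nonneg hrr hcr
  rw [← Finset.sum_union hdisj] at hsum
  refine hsum.trans (Finset.sum_le_sum_of_subset_of_nonneg (fun T hT => ?_) (fun T hT hT' => ?_))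
  · rw [Finset.mem_union] at hT
    simp only [Finset.mem_filter, Finset.mem_univ, true_and] at hT ⊢
    rcases hT with h | h
    · exact ⟨h.1, h.2.1⟩
    · exact ⟨h.1, h.2.1⟩
  · rw [Finset.mem_union, not_or] at hT'
    simp only [Finset.mem_filter, Finset.mem_univ, true_and] at hT hT'
    obtain ⟨hPX, hPY⟩ := hT
    obtain ⟨h1, h2⟩ := hT'
    have hnoRR : ∀ v, v ≠ s → v ≠ P → s(s, v) ∈ E → ¬ (s(s, v) ∈ T ∧ s(P, v) ∈ T) :=
      fun v hvs hvP hvE h => h1 ⟨hPX, hPY, v, hvs, hvP, hvE, h.1, h.2⟩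
    have hnoX : ∀ j k, j ≠ s → j ≠ P → s(s, j) ∈ E → k ≠ s → k ≠ P → s(s, k) ∈ E → s(s, j) ∉ T → s(s, k) ∈ T →
        s(j, k) ∈ E → s(j, k) ∉ T :=
      fun j k hjs hjP hjE hks hkP hkE hsj hsk hjkE hjk => h2 ⟨hPX, hPY, hnoRR, j, k, hjs, hjP, hjE, hks, hkP, hkE, hsj, hsk, hjkE, hjk⟩
    have hYX := nested_of_rest hsP hsPE hdom hcut hPX hPY hnoRR hnoX
    have ha : 0 ≤ K₁ (openCluster (T ∩ E) s) (openCluster (Tᶜ ∩ E) s) := by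
      have h' := hso₁ (openCluster (Tᶜ ∩ E) s) (openCluster (Tᶜ ∩ E) s)
      have h'' := hK₁ hYX (subset_refl (openCluster (Tᶜ ∩ E) s))
      linarith
    have hb : 0 ≤ K₂ (openCluster (T ∩ E) s) (openCluster (Tᶜ ∩ E) s) := by
      have h' := hso₂ (openCluster (Tᶜ ∩ E) s) (openCluster (Tᶜ ∩ E) s)
      have h'' := hK₂ hYX (subset_refl (openCluster (Tᶜ ∩ E) s))
      linarith
    exact mul_nonneg ha hb

/-- **THEOREM TXG (the |R| = 1 vertex antithetic inequality at a vertex dominating the source, cut form).** [this work] -/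
theorem vertex_sum_nonneg_of_cut (E : Set (Sym2 V)) (s P : V) (hsP : s ≠ P) (hsPE : s(s, P) ∉ E)
    (hdom : ∀ v, v ≠ s → v ≠ P → s(s, v) ∈ E → s(P, v) ∈ E)
    (hcut : ∀ S : Set V, (∃ j ∈ S, j ≠ s ∧ j ≠ P ∧ s(s, j) ∈ E) → (∃ k ∉ S, k ≠ s ∧ k ≠ P ∧ s(s, k) ∈ E) →
      (∀ j k, j ∈ S → k ∉ S → j ≠ s → j ≠ P → s(s, j) ∈ E → k ≠ s → k ≠ P → s(s, k) ∈ E → s(j, k) ∉ E) →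
      ∀ w u, w ≠ s → w ≠ P → s(s, w) ∉ E → s(P, w) ∉ E → u ≠ w → s(u, w) ∈ E →
        ∃ k ∉ S, k ≠ s ∧ k ≠ P ∧ s(s, k) ∈ E ∧ s(w, k) ∈ E)
    {F G : Set V → ℝ} (hF : Monotone F) (hG : Monotone G) :
    0 ≤ ∑ T ∈ Finset.univ.filter (fun T : Set (Sym2 V) =>
        ¬ ((openGraph (T ∩ E)).Reachable s P ∧ (openGraph (Tᶜ ∩ E)).Reachable s P)),
      (F (openCluster (T ∩ E) s) - F (openCluster (Tᶜ ∩ E) s)) * (G (openCluster (T ∩ E) s) - G (openCluster (Tᶜ ∩ E) s)) := by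
  refine TopVertex.vertex_sum_nonneg_of_top E s P (fun F' G' hF' hG' => ?_) hF hG
  have hK₁ : ∀ ⦃A A' B B' : Set V⦄, A ⊆ A' → B' ⊆ B → F' A - F' B ≤ F' A' - F' B' :=
    fun A A' B B' hA hB => sub_le_sub (hF' hA) (hF' hB)
  have hK₂ : ∀ ⦃A A' B B' : Set V⦄, A ⊆ A' → B' ⊆ B → G' A - G' B ≤ G' A' - G' B' :=
    fun A A' B B' hA hB => sub_le_sub (hG' hA) (hG' hB)
  have hso₁ : ∀ A B : Set V, 0 ≤ (F' A - F' B) + (F' B - F' A) := fun A B => by linarith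
  have hso₂ : ∀ A B : Set V, 0 ≤ (G' A - G' B) + (G' B - G' A) := fun A B => by linarith
  exact top_sum_nonneg_of_cut E s P hsP hsPE hdom hcut (K₁ := fun A B => F' A - F' B) (K₂ := fun A B => G' A - G' B)
    hK₁ hso₁ hK₂ hso₂

/-- **COROLLARY (connected source neighbourhood).**  For every finite graph `E`, every source `s` whose neighbourhood induces a CONNECTED
subgraph (`hconn`: every set containing a neighbour of `s` and missing another is left by an `E`-pair between two neighbours of `s`), and
every vertex `P ≠ s`, `sP ∉ E`, adjacent to ALL neighbours of `s`: the |R| = 1 vertex antithetic inequality holds at `P`,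
`0 ≤ Σ_{T : ¬(P ∈ X T ∧ P ∈ Y T)} (F(X T) − F(Y T))·(G(X T) − G(Y T))` for all monotone `F, G`. [this work] -/
theorem vertex_sum_nonneg_of_connected (E : Set (Sym2 V)) (s P : V) (hsP : s ≠ P) (hsPE : s(s, P) ∉ E)
    (hdom : ∀ v, v ≠ s → v ≠ P → s(s, v) ∈ E → s(P, v) ∈ E)
    (hconn : ∀ S : Set V, (∃ j ∈ S, j ≠ s ∧ j ≠ P ∧ s(s, j) ∈ E) → (∃ k ∉ S, k ≠ s ∧ k ≠ P ∧ s(s, k) ∈ E) →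
      ∃ j ∈ S, ∃ k ∉ S, j ≠ s ∧ j ≠ P ∧ s(s, j) ∈ E ∧ k ≠ s ∧ k ≠ P ∧ s(s, k) ∈ E ∧ s(j, k) ∈ E)
    {F G : Set V → ℝ} (hF : Monotone F) (hG : Monotone G) :
    0 ≤ ∑ T ∈ Finset.univ.filter (fun T : Set (Sym2 V) =>
        ¬ ((openGraph (T ∩ E)).Reachable s P ∧ (openGraph (Tᶜ ∩ E)).Reachable s P)),
      (F (openCluster (T ∩ E) s) - F (openCluster (Tᶜ ∩ E) s)) * (G (openCluster (T ∩ E) s) - G (openCluster (Tᶜ ∩ E) s)) := by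
  refine vertex_sum_nonneg_of_cut E s P hsP hsPE hdom (fun S hJ hK hno w u _ _ _ _ _ _ => ?_) hF hG
  obtain ⟨j, hj, k, hk, hjs, hjP, hjE, hks, hkP, hkE, hjkE⟩ := hconn S hJ hK
  exact absurd hjkE (hno j k hj hk hjs hjP hjE hks hkP hkE)

end Dom

end Antithetic

end Summit.CriticalPhenomena.PercolationContinuityZ3.Theorems
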